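import Summits.QuantumFields.BalabanUV.T4Continuum.Support.NE9B11SolutionAnalytic
import Summits.QuantumFields.BalabanUV.T4Continuum.Support.NE9CurveFromBackgroundMap

/-!
# NE9CurOfB11Chart — THE SCHEME-LEVEL (174) ∘ (47) CHART, READ IN THE END's CHART SPACE, FIRES THE `cur` SPECIES' LEAF A3
# (`NE9CurveFromBackgroundMap.cpieceResponse_compCur`) BY NAME (route R2′ of `t4/ROUTES-NE9.md` v2, the END-side corollary of
# `NE9B11SolutionAnalytic` p249501; cell `pub-balaban`, T4-DAG §2 node U3 ∕ §6 NE9; BINDER row NE9 OWNER lineage `b2b-balaban-t4-ne9-p1`,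
# generation 59; Summits-side NEW work, nothing printed asserted)

HONEST FRAMING (T4-DAG PAGE 1).  Rung (B)+1 of the FINITE-VOLUME T⁴ programme — NOT infinite volume, NOT a mass gap, NOT the Clay
problem.  NE9 (`T4OutputRate.NE9` ∧ `FadingMemory`) is a cell NEW ESTIMATE, NOT PRINTED in [I] = [Balaban1987RG1] (CMP **109**), [II] =
[Balaban1988RG2Cluster] (CMP **116**), and NOT PROVED here («NE9 ⇐ the named binders»; spine PROVED 0∕9).  HONEST DEPENDENCY (cell line,
verbatim): continuum YM on T⁴ ⇐ BetaPertH ∧ nine spine estimates (0/9 proved); BetaPertH ⇐ (D1) ∧ (D4) ∧ CAP+tail; G-an2-4 gates asym, D1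
and NE2/3/4.  MECHANISM ONLY over the abstract scheme of `B11Prop6Scheme`; nothing of [15] = [Balaban1985Variational] (CMP **102**) is
asserted; no lattice carrier is typed (route step B2′ = socket C19′, FROZEN under ruling e34b3e0c (0)).

WHAT.  `NE9B11SolutionAnalytic.exists_backgroundMap_of_twoSchemes` delivers, from the two contraction schemes' letters alone, ONE map
`Ψ₀ : ℬ → 𝒴` (B-fields ↦ configurations; (174) of the (175) solution through (47) of the (50) solution) with (Ψ1)–(Ψ3) on
`ball 0 R → ball 0 R′`.  The END's species (a) reads slice curves in ONE chart space `E` per localization domain `X`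
(`NE9CurveFromBackgroundMap`: `Ψ X : E → E` on `ball 0 (D.R X) → ball 0 (R′ X)`).  The READING is two continuous linear letters per
domain — `ι X : E →L[ℂ] ℬ` (the shift-field direction read as a B-field; [II] (1.1)∕(1.23)) and `π X : 𝒴 →L[ℂ] E` (restriction to `X` +
chart coordinates of `U^c_j(X, α₀, α₁)`; [I] (3.53) p. 280) — with the two ball inclusions as their displayed-type content:
* §1 `triple_read` — (Ψ1)–(Ψ3) are stable under such a reading: `π ∘ Ψ₀ ∘ ι` has them on `ball 0 r → ball 0 r′` whenever `ι` maps
  `ball 0 r` into `ball 0 R` and `π` maps `ball 0 R′` into `ball 0 r′` [folklore];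
* §2 **`cpieceResponse_compCur_of_twoSchemes`** — `NE9CurveFromBackgroundMap.cpieceResponse_compCur` BY NAME with its three
  background-map binders `hΨan ∕ hΨmaps ∕ hΨ0` DISCHARGED by the two schemes + the readings: the conclusion (leaf A3 of the curve species
  for the composite datum `D.compCur Ψ R′`) VERBATIM, every other binder of that theorem VERBATIM.
So on route R2′ the `cur` species' leaf A3 asks of Bałaban's objects: the ray species' binders on the SHIFT FIELD (unchanged), the two
schemes' LETTERS with their displayed bounds (B2′ = C19′), and two linear readings per domain with two ball inclusions — and nothing
else of (D1) for `cur`.  DISGUISE TEST: composition with linear maps + one application by name; no inequality of the series; not NE9;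
0 def, 0 sorry.

References (TYPES ∕ loci only): [Balaban1985Variational] T. Bałaban, CMP **102** (1985) 277–309, (47) p. 285, (174)–(175) p. 305, Prop. 9
p. 309; [Balaban1987RG1] T. Bałaban, CMP **109** (1987), (3.37) p. 277, Lemma 4 (3.53) p. 280; [Balaban1988RG2Cluster] T. Bałaban, CMP **116**
(1988), (1.1) p. 3, (1.21)–(1.25) p. 7.  Imports `NE9B11SolutionAnalytic` (p249501) and `NE9CurveFromBackgroundMap` ONLY; modifies nothing; no
END re-wired.  Value = route-R2′'s object reaches species (a)'s leaf A3 in the kernel, NOT summit progress.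
-/

noncomputable section

open scoped BigOperators
open Metric Set

namespace Summit.QuantumFields.BalabanUV.T4Continuum.NE9CurOfB11Chart

open Literature.MathematicalPhysics.QuantumFieldTheory.Balaban1983to89
open Literature.MathematicalPhysics.QuantumFieldTheory.Balaban1983to89.T4OutputRate
open Literature.MathematicalPhysics.QuantumFieldTheory.Balaban1983to89.T4HistoryLipschitzRecursion
open Literature.MathematicalPhysics.QuantumFieldTheory.Balaban1983to89.T4HistoryLipschitzSegment
open Literature.MathematicalPhysics.QuantumFieldTheory.Balaban1983to89.B13Contraction113 (QuadAnalytic)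
open Literature.MathematicalPhysics.QuantumFieldTheory.Balaban1983to89.B11Prop6Scheme (mapT)
open Summit.QuantumFields.BalabanUV.T4Continuum.NE9Lemma1PieceClass
open Summit.QuantumFields.BalabanUV.T4Continuum.NE9Lemma1RemainderSpecies
open Summit.QuantumFields.BalabanUV.T4Continuum.NE9Lemma1CurveSpecies
open Summit.QuantumFields.BalabanUV.T4Continuum.NE9CurveFromBackgroundMap
open Summit.QuantumFields.BalabanUV.T4Continuum.NE9ComplexEncoding (doubleCarriers)
open Summit.QuantumFields.BalabanUV.T4Continuum.NE9B11SolutionAnalytic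

/-! ## §1 (Ψ1)–(Ψ3) are stable under linear readings -/

/-- [folklore] **READING A BACKGROUND MAP IN ANOTHER CHART SPACE.**  If `Ψ₀ : ℬ → 𝒴` is `DifferentiableOn ℂ` on `ball 0 R`, maps it into
`ball 0 R′` and fixes `0`, and `ι : E →L[ℂ] ℬ`, `π : 𝒴 →L[ℂ] E′` are continuous linear with `ι (ball 0 r) ⊆ ball 0 R`,
`π (ball 0 R′) ⊆ ball 0 r′`, then `π ∘ Ψ₀ ∘ ι` is `DifferentiableOn ℂ` on `ball 0 r`, maps it into `ball 0 r′`, and fixes `0`. -/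
theorem triple_read {ℬ 𝒴 E E' : Type*} [NormedAddCommGroup ℬ] [NormedSpace ℂ ℬ] [NormedAddCommGroup 𝒴] [NormedSpace ℂ 𝒴]
    [NormedAddCommGroup E] [NormedSpace ℂ E] [NormedAddCommGroup E'] [NormedSpace ℂ E']
    {Ψ₀ : ℬ → 𝒴} {R R' : ℝ} (h1 : DifferentiableOn ℂ Ψ₀ (ball 0 R)) (h2 : MapsTo Ψ₀ (ball 0 R) (ball 0 R')) (h3 : Ψ₀ 0 = 0)
    (ι : E →L[ℂ] ℬ) (π : 𝒴 →L[ℂ] E') {r r' : ℝ} (hι : MapsTo ι (ball 0 r) (ball 0 R)) (hπ : MapsTo π (ball 0 R') (ball 0 r')) :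
    DifferentiableOn ℂ (fun e => π (Ψ₀ (ι e))) (ball 0 r) ∧ MapsTo (fun e => π (Ψ₀ (ι e))) (ball 0 r) (ball 0 r') ∧
      π (Ψ₀ (ι 0)) = 0 := by
  refine ⟨π.differentiable.comp_differentiableOn ((h1.comp ι.differentiable.differentiableOn) hι), fun e he => hπ (h2 (hι he)), ?_⟩
  rw [map_zero, h3, map_zero]

/-! ## §2 Leaf A3 of the curve species for the (174) ∘ (47) chart of the two schemes -/

variable {C : Carriers} {E : Type} [NormedAddCommGroup E] [NormedSpace ℂ E] {ι' α β γ δ : Type} [DecidableEq δ]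

/-- **LEAF A3 OF THE `cur` SPECIES FOR THE (174) ∘ (47) CHART OF B11's TWO CONTRACTION SCHEMES, READ PER DOMAIN IN THE END's CHART SPACE.**
Inputs: (i) the ray datum `D` with `RemData.Admissible ℓ c_dir d₀`, `0 < dirB`, contour continuity `hcont` and the coupling-Lipschitz
binder `hlip` of the shift-field directions, the family `Ef` analytic on the `R′`-balls with `TermSize`, and the counts — VERBATIM the
binders of `NE9CurveFromBackgroundMap.cpieceResponse_compCur`; (ii) IN PLACE OF its three background-map binders `hΨan ∕ hΨmaps ∕ hΨ0`:
the letters and smallness conditions of the Sect. E∕G scheme (`𝒢 = 𝔊`, `W = (δ/δA′)V`; (175)) and of the Sect. C scheme (`H`, `C`;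
(47)∕(50)) of [15] EXACTLY as in `NE9B11SolutionAnalytic.exists_backgroundMap_of_twoSchemes`, the linear minimiser `H₁ : ℬ →L[ℂ] 𝒴` with
`‖H₁B‖ < a` on `‖B‖ < R`, a chart radius `R₀′ > 0` with `(ε₄ + a)∕(1 − q_C) ≤ R₀′`, and per localization domain `X` two linear READINGS
`ιr X : E →L[ℂ] ℬ` (`ball 0 (D.R X) ↦ ball 0 R`) and `πr X : 𝒴 →L[ℂ] E` (`ball 0 R₀′ ↦ ball 0 (R′ X)`).  Conclusion: there is a
background-map family `Ψ : C.Dom → E → E` — `Ψ X = πr X ∘ (174)∘(47)-chart ∘ ιr X` — for which the conclusion of `cpieceResponse_compCur`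
holds for the composite datum `D.compCur Ψ R′` VERBATIM (`qc := 64·(4·clipd)·Nbar`). [cite: Balaban1985Variational, (47) p.285, (174)-(175) p.305, Prop. 9 p.309; Balaban1987RG1, (3.37) p.277, (3.53)-(3.54) p.280; Balaban1988RG2Cluster, (1.21)-(1.25) p.7] -/
theorem cpieceResponse_compCur_of_twoSchemes
    -- the two schemes (as in `exists_backgroundMap_of_twoSchemes`)
    {𝒴 𝒵 𝒳 ℬ : Type} [NormedAddCommGroup 𝒴] [NormedSpace ℂ 𝒴] [CompleteSpace 𝒴] [NormedAddCommGroup 𝒵] [NormedSpace ℂ 𝒵]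
    [NormedAddCommGroup 𝒳] [NormedSpace ℂ 𝒳] [NormedAddCommGroup ℬ] [NormedSpace ℂ ℬ]
    {𝒢 : 𝒵 →L[ℂ] 𝒴} {W : 𝒴 → 𝒵} {B₀ C₄ a₃ : ℝ}
    (h𝒢 : ∀ f, ‖𝒢 f‖ ≤ B₀ * ‖f‖) (hW : QuadAnalytic W C₄ a₃) (hWa : AnalyticOnNhd ℂ W {Y : 𝒴 | ‖Y‖ < a₃})
    (hB₀ : 0 ≤ B₀) (hC₄ : 0 ≤ C₄) {a ε₄ : ℝ} (ha : 0 < a) (hε₄ : 0 ≤ ε₄) (hdom : 2 * (ε₄ + a) ≤ a₃)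
    (hself : B₀ * C₄ * (ε₄ + a) ^ 2 ≤ ε₄) (hcontr : 4 * B₀ * C₄ * (ε₄ + a) < 1)
    {H : 𝒳 →L[ℂ] 𝒴} {Cq : 𝒴 → 𝒳} {b C₂ c₄ : ℝ}
    (hH : ∀ f, ‖H f‖ ≤ b * ‖f‖) (hC : QuadAnalytic Cq C₂ c₄) (hCa : AnalyticOnNhd ℂ Cq {Y : 𝒴 | ‖Y‖ < c₄})
    (hb : 0 ≤ b) (hC₂ : 0 ≤ C₂) {aC εC : ℝ} (haCge : ε₄ + a ≤ aC) (hεC : 0 ≤ εC) (hdomC : 2 * (εC + aC) ≤ c₄)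
    (hselfC : b * C₂ * (εC + aC) ^ 2 ≤ εC) (hcontrC : 4 * b * C₂ * (εC + aC) < 1)
    (H₁ : ℬ →L[ℂ] 𝒴) {R : ℝ} (hR : ∀ B ∈ ball (0 : ℬ) R, ‖H₁ B‖ < a)
    {R₀' : ℝ} (hR₀'0 : 0 < R₀') (hR₀' : 1 / (1 - 4 * b * C₂ * (εC + aC)) * (ε₄ + a) ≤ R₀')
    -- the readings, per localization domain
    {D : RemData C E ι' α β γ δ} {R' : C.Dom → ℝ} (ιr : C.Dom → (E →L[ℂ] ℬ)) (πr : C.Dom → (𝒴 →L[ℂ] E))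
    (hιr : ∀ X, MapsTo (ιr X) (ball 0 (D.R X)) (ball 0 R)) (hπr : ∀ X, MapsTo (πr X) (ball 0 R₀') (ball 0 (R' X)))
    -- the ray datum and the rest of `cpieceResponse_compCur`'s binders, verbatim
    {ℓ : ℕ → ℕ → ℝ} {cdir d0 : ℝ} (hD : D.Admissible ℓ cdir d0) (hpos : ∀ k s y a b x, 0 < D.dirB k s y a b x)
    {Ef : Functional (doubleCarriers C) E} {Wd : Set (ℕ → ℝ)} {κ : ℝ} {N : ℕ → ℝ} {Nbar clipd : ℝ}
    (hE : ∀ g ∈ Wd, Ef g ∈ analyticClass R') (hT : TermSize Ef Wd κ N) (hN0 : ∀ j, 0 ≤ N j) (hNb : ∀ j, N j ≤ Nbar)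
    (hclipd : 0 ≤ clipd) (hcdir : 0 < cdir) (hℓ : ∀ k j, 0 < ℓ k j) (hhalf : ∀ k j, cdir * ℓ k j < 1 / 2)
    (hcont : ∀ (k : ℕ) (s : ℕ → ℝ) (y : ι') (a : α) (b : β) (x : (doubleCarriers C).Dom),
      ContinuousOn (fun p : ℂ × ((δ → ℝ) × (δ → ℂ)) => D.dir k s y a b x p.1 p.2.1 p.2.2)
        (sphere (0:ℂ) (D.r k) ×ˢ {q | OnContour D.κ₁ (D.cubes k y a b) q.1 q.2}))
    (hlip : ∀ g ∈ Wd, ∀ g' ∈ Wd, ∀ (k : ℕ) (y : ι'), ∀ a ∈ D.S0 k y, ∀ b ∈ D.SY k y a, ∀ (j : ℕ), ∀ x ∈ D.src k y a j,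
      ∀ t ∈ sphere (0:ℂ) (D.r k), ∀ (s' : δ → ℝ) (σ' : δ → ℂ), OnContour D.κ₁ (D.cubes k y a b) s' σ' →
        ‖D.dir k g y a b x t s' σ' - D.dir k g' y a b x t s' σ'‖ ≤ clipd * (cdir * ℓ k j * D.R x.1) * |g k - g' k|) :
    ∃ (T Xs : 𝒴 → 𝒴) (Ψ : C.Dom → E → E),
      (∀ X e, Ψ X e = πr X (T (Xs (H₁ (ιr X e)) + H₁ (ιr X e)))) ∧
      (∀ 𝔄 ∈ ball (0 : 𝒴) a, ‖Xs 𝔄‖ ≤ ε₄ ∧ Xs 𝔄 + 𝒢 (W (Xs 𝔄 + 𝔄)) = 0) ∧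
      (∀ A' ∈ ball (0 : 𝒴) aC, T A' - A' = -H (Cq (T A'))) ∧
      ∀ g ∈ Wd, ∀ g' ∈ Wd, ∀ (k : ℕ) (y : ι'), ∀ a ∈ (D.compCur Ψ R').toC.S0 k y, ∀ b ∈ (D.compCur Ψ R').toC.SY k y a,
        ∀ (j : ℕ), ∀ x ∈ (D.compCur Ψ R').toC.src k y a j,
        |(D.compCur Ψ R').toC.piece k g y a b x (Ef g) - (D.compCur Ψ R').toC.piece k g' y a b x (Ef g)| ≤
          (D.compCur Ψ R').Kp cdir k y * (64 * (4 * clipd) * Nbar) * ℓ k j ^ 5 * Real.exp (-(κ * (doubleCarriers C).d x)) *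
            Real.exp (-(1 / 8) * ((D.compCur Ψ R').κ₁ - 1) * (D.compCur Ψ R').toC.dY k y + (1 / 8) * (D.compCur Ψ R').κ₁ * d0 -
              (1 / 2) * ((D.compCur Ψ R').κ₁ - 1) * (D.compCur Ψ R').toC.vol k y a b) *
              |g k - g' k| := by
  obtain ⟨T, Xs, hTsol, hXs, -, -, hΨ1, hΨ2, hΨ3⟩ := exists_backgroundMap_of_twoSchemes h𝒢 hW hWa hB₀ hC₄ ha hε₄ hdom hself hcontr
    hH hC hCa hb hC₂ haCge hεC hdomC hselfC hcontrC H₁ hR hR₀'0 hR₀'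
  set Ψ : C.Dom → E → E := fun X e => πr X (T (Xs (H₁ (ιr X e)) + H₁ (ιr X e))) with hΨdef
  have htr : ∀ X, DifferentiableOn ℂ (Ψ X) (ball 0 (D.R X)) ∧ MapsTo (Ψ X) (ball 0 (D.R X)) (ball 0 (R' X)) ∧ Ψ X 0 = 0 :=
    fun X => triple_read hΨ1 hΨ2 hΨ3 (ιr X) (πr X) (hιr X) (hπr X)
  refine ⟨T, Xs, Ψ, fun X e => rfl, fun 𝔄 h𝔄 => ⟨(hXs 𝔄 h𝔄).1, (hXs 𝔄 h𝔄).2.1⟩, fun A' hA' => (hTsol A' hA').2.1, ?_⟩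
  exact cpieceResponse_compCur hD hpos (fun X => (htr X).1) (fun X => (htr X).2.1) (fun X => (htr X).2.2) hE hT hN0 hNb hclipd
    hcdir hℓ hhalf hcont hlip

end Summit.QuantumFields.BalabanUV.T4Continuum.NE9CurOfB11Chart

end
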